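import Summits.AtomisticToContinuum.FouriersLaw.Theorems.BondHeatUncertaintySubdiffusiveBondHeatGibbsMomentumFourthMoment
import Literature.MathematicalPhysics.KineticTheory.LangevinChainHormander

/-!
# `N`-uniform statics for the bond-heat window laws, part B: integration by parts against `e^{-H/T}`

Support file for item `stmt-AtomisticToContinuum-9123` (`BondHeatUncertainty.LightConeBondHeat`); see part A
(`…LightConeBondHeatVirialAlgebra`) for the role of these statics.  For the pinned anharmonic chain
`pinnedChain ω₂ lam β γ` (`ω₂ > 0`, `lam > 0` where stated, `β ≥ 0`, `T > 0`) and the unnormalised Gibbs density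
`ρ = e^{-H/T}` on phase space (Lebesgue measure):

* domination: `(1+H)^m ρ ∈ L¹` for every `m` (`one_add_pow_le_exp`), hence every continuous `g = O((1+H)^m)` has
  `g ρ ∈ L¹` (`pinnedChain_integrable_mul_gibbsDensity_of_le_pow`); pointwise energy bounds for `|q_i|^n`, `q_i⁶`,
  the bond stretch `r = q_l − q_k` and `∂_{q_i}H`;
* **position virial identity** `∫ q_i^n ∂_{q_i}H ρ = nT ∫ q_i^{n-1} ρ` for `1 ≤ n ≤ 3`
  (`pinnedChain_integral_position_pow_mul_partialQ`);
* **Gaussian momentum identity with a configurational weight** `∫ p_k² G(q) ρ = T ∫ G(q) ρ` for continuous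
  `G = O((1+H)²)` (`pinnedChain_integral_momentum_sq_mul_posFun`).
Both are instances of Mathlib's `integral_bilinear_hasLineDerivAt_right_eq_neg_left_of_integrable` through the tree's
`integral_mul_eq_neg_of_hasLineDerivAt_of_integrable` (file `…SubdiffusiveBondHeatGibbsMomentumFourthMoment`).
-/

noncomputable section

open MeasureTheory

namespace Summit.AtomisticToContinuum.FouriersLaw.Theorems.LightConeBondHeat

open Literature.MathematicalPhysics.KineticTheory.HeatConduction
open Summit.AtomisticToContinuum.FouriersLaw.Theorems.SubdiffusiveBondHeat

variable {N : ℕ}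

/-! ### Domination by powers of the energy -/

/-- `(1 + t)^m ≤ (m! e^s / s^m) e^{s t}` for `t ≥ 0`, `s > 0`. [folklore] -/
theorem one_add_pow_le_exp (m : ℕ) {t s : ℝ} (ht : 0 ≤ t) (hs : 0 < s) :
    (1 + t) ^ m ≤ (m.factorial * Real.exp s / s ^ m) * Real.exp (s * t) := by
  have h := Real.pow_div_factorial_le_exp (s * (1 + t)) (by positivity) m
  have h2 : Real.exp (s * (1 + t)) = Real.exp s * Real.exp (s * t) := by
    rw [mul_add, mul_one, Real.exp_add]
  rw [mul_pow, h2] at h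
  have hm : (0:ℝ) < m.factorial := by exact_mod_cast m.factorial_pos
  have hsm : 0 < s ^ m := pow_pos hs m
  rw [div_le_iff₀ hm] at h
  rw [div_mul_eq_mul_div, le_div_iff₀ hsm]
  calc (1 + t) ^ m * s ^ m = s ^ m * (1 + t) ^ m := by ring
    _ ≤ Real.exp s * Real.exp (s * t) * m.factorial := h
    _ = m.factorial * Real.exp s * Real.exp (s * t) := by ring

/-- `∂_{q_i} q_i^n = n q_i^{n-1}`, as a line derivative along `(e_i, 0)`. [folklore] -/
theorem hasLineDerivAt_position_pow (n : ℕ) (x : PhaseSpace N) (i : Fin N) :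
    HasLineDerivAt ℝ (fun z : PhaseSpace N => z.1 i ^ n) ((n : ℝ) * x.1 i ^ (n - 1)) x
      ((Pi.single i 1, 0) : PhaseSpace N) := by
  unfold HasLineDerivAt
  have h : (fun t : ℝ => (fun z : PhaseSpace N => z.1 i ^ n)
      (x + t • ((Pi.single i 1, 0) : PhaseSpace N))) = fun t => (x.1 i + t) ^ n := by
    funext t
    simp
  rw [h]
  have h1 : HasDerivAt (fun t : ℝ => x.1 i + t) 1 0 := (hasDerivAt_id' (0 : ℝ)).const_add _
  refine (h1.fun_pow n).congr_deriv ?_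
  simp

/-- `∂_{p_k} (p_k G(q)) = G(q)` for a function `G` of the positions, as a line derivative along `(0, e_k)`.
[folklore] -/
theorem hasLineDerivAt_momentum_mul_posFun (G : (Fin N → ℝ) → ℝ) (x : PhaseSpace N) (k : Fin N) :
    HasLineDerivAt ℝ (fun z : PhaseSpace N => z.2 k * G z.1) (G x.1) x ((0, Pi.single k 1) : PhaseSpace N) := by
  unfold HasLineDerivAt
  have h : (fun t : ℝ => (fun z : PhaseSpace N => z.2 k * G z.1)
      (x + t • ((0, Pi.single k 1) : PhaseSpace N))) = fun t => (x.2 k + t) * G x.1 := by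
    funext t
    simp
  rw [h]
  have h1 : HasDerivAt (fun t : ℝ => x.2 k + t) 1 0 := (hasDerivAt_id' (0 : ℝ)).const_add _
  refine (h1.mul_const (G x.1)).congr_deriv ?_
  simp

section Pinned

variable {ω₂ lam β : ℝ}

/-- `(1 + H)^m e^{-H/T}` is Lebesgue integrable for the pinned chain, every `m` (`ω₂ > 0`, `lam, β ≥ 0`, `T > 0`).
[folklore] -/
theorem pinnedChain_integrable_one_add_pow_mul_gibbsDensity (hω : 0 < ω₂) (hl : 0 ≤ lam) (hβ : 0 ≤ β) (γ : ℝ)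
    (N : ℕ) {T : ℝ} (hT : 0 < T) (m : ℕ) :
    Integrable fun x => (1 + (pinnedChain ω₂ lam β γ).hamiltonian N x) ^ m *
      (pinnedChain ω₂ lam β γ).gibbsDensity N T x := by
  have hT' : 0 < T⁻¹ := inv_pos.mpr hT
  have hs : 0 < T⁻¹ / 2 := by positivity
  have hs' : T⁻¹ / 2 < 1 / T := by rw [one_div]; linarith
  have hmaj := (pinnedChain_integrable_exp_mul_gibbsDensity hω hl hβ γ N hT hs').const_mul
    (m.factorial * Real.exp (T⁻¹ / 2) / (T⁻¹ / 2) ^ m)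
  refine hmaj.mono' ?_ (Filter.Eventually.of_forall fun x => ?_)
  · exact (((continuous_const.add (pinnedChain_continuous_hamiltonian ω₂ lam β γ N)).pow m).mul
      (pinnedChain_continuous_gibbsDensity ω₂ lam β γ N T)).aestronglyMeasurable
  have hH0 := pinnedChain_hamiltonian_nonneg hω.le hl hβ γ N x
  have hpow := one_add_pow_le_exp m hH0 hs
  have hρ : 0 < (pinnedChain ω₂ lam β γ).gibbsDensity N T x := (pinnedChain ω₂ lam β γ).gibbsDensity_pos N T x
  rw [Real.norm_eq_abs, abs_mul, abs_of_pos hρ, abs_of_nonneg (by positivity)]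
  calc (1 + (pinnedChain ω₂ lam β γ).hamiltonian N x) ^ m * (pinnedChain ω₂ lam β γ).gibbsDensity N T x
      ≤ (m.factorial * Real.exp (T⁻¹ / 2) / (T⁻¹ / 2) ^ m) *
          Real.exp (T⁻¹ / 2 * (pinnedChain ω₂ lam β γ).hamiltonian N x) *
          (pinnedChain ω₂ lam β γ).gibbsDensity N T x := mul_le_mul_of_nonneg_right hpow hρ.le
    _ = _ := by rw [mul_assoc]

/-- A continuous observable dominated by `C (1 + H)^m` is integrable against `e^{-H/T}` (pinned chain, `T > 0`).
[folklore] -/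
theorem pinnedChain_integrable_mul_gibbsDensity_of_le_pow (hω : 0 < ω₂) (hl : 0 ≤ lam) (hβ : 0 ≤ β) (γ : ℝ)
    (N : ℕ) {T : ℝ} (hT : 0 < T) (m : ℕ) {g : PhaseSpace N → ℝ} (hg : Continuous g) {C : ℝ}
    (hle : ∀ x, |g x| ≤ C * (1 + (pinnedChain ω₂ lam β γ).hamiltonian N x) ^ m) :
    Integrable fun x => g x * (pinnedChain ω₂ lam β γ).gibbsDensity N T x := by
  have hmaj := (pinnedChain_integrable_one_add_pow_mul_gibbsDensity hω hl hβ γ N hT m).const_mul C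
  refine hmaj.mono' ((hg.mul (pinnedChain_continuous_gibbsDensity ω₂ lam β γ N T)).aestronglyMeasurable)
    (Filter.Eventually.of_forall fun x => ?_)
  have hρ : 0 < (pinnedChain ω₂ lam β γ).gibbsDensity N T x := (pinnedChain ω₂ lam β γ).gibbsDensity_pos N T x
  rw [Real.norm_eq_abs, abs_mul, abs_of_pos hρ, ← mul_assoc]
  exact mul_le_mul_of_nonneg_right (hle x) hρ.le

/-! ### Pointwise bounds in terms of the energy -/

/-- `|q_i|^n ≤ (1 + 4/lam)(1 + H)` for `n ≤ 4` (pinned chain with quartic pinning `lam > 0`: `lam q⁴/4 ≤ H`). [folklore] -/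
theorem pinnedChain_abs_position_pow_le (hω : 0 ≤ ω₂) (hl : 0 < lam) (hβ : 0 ≤ β) (γ : ℝ) (N : ℕ)
    (x : PhaseSpace N) (i : Fin N) {n : ℕ} (hn : n ≤ 4) :
    |x.1 i ^ n| ≤ (1 + 4 / lam) * (1 + (pinnedChain ω₂ lam β γ).hamiltonian N x) := by
  have hU := pinnedChain_U_le_hamiltonian hω hl.le hβ γ N x i
  have hH0 := pinnedChain_hamiltonian_nonneg hω hl.le hβ γ N x
  have hq4 : x.1 i ^ 4 ≤ 4 / lam * (pinnedChain ω₂ lam β γ).hamiltonian N x := by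
    rw [div_mul_eq_mul_div, le_div_iff₀ hl]
    nlinarith [mul_nonneg hω (sq_nonneg (x.1 i))]
  rw [abs_pow]
  have h := abs_pow_le_one_add_pow_four hn (x.1 i)
  have h4l : 0 ≤ 4 / lam := by positivity
  nlinarith [mul_nonneg h4l hH0]

/-- `q_i⁶ ≤ (8/(ω₂ lam)) (1 + H)²` (`ω₂ q²/2 ≤ H` and `lam q⁴/4 ≤ H`). [folklore] -/
theorem pinnedChain_position_pow_six_le (hω : 0 < ω₂) (hl : 0 < lam) (hβ : 0 ≤ β) (γ : ℝ) (N : ℕ)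
    (x : PhaseSpace N) (i : Fin N) :
    x.1 i ^ 6 ≤ 8 / (ω₂ * lam) * (1 + (pinnedChain ω₂ lam β γ).hamiltonian N x) ^ 2 := by
  set H := (pinnedChain ω₂ lam β γ).hamiltonian N x
  have hU := pinnedChain_U_le_hamiltonian hω.le hl.le hβ γ N x i
  have hH0 : 0 ≤ H := pinnedChain_hamiltonian_nonneg hω.le hl.le hβ γ N x
  have hq2 : ω₂ * x.1 i ^ 2 ≤ 2 * H := by nlinarith [mul_nonneg hl.le (by positivity : (0:ℝ) ≤ x.1 i ^ 4)]
  have hq4 : lam * x.1 i ^ 4 ≤ 4 * H := by nlinarith [mul_nonneg hω.le (sq_nonneg (x.1 i))]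
  have hprod : (ω₂ * lam) * x.1 i ^ 6 ≤ 8 * H ^ 2 := by
    have e : (ω₂ * lam) * x.1 i ^ 6 = (ω₂ * x.1 i ^ 2) * (lam * x.1 i ^ 4) := by ring
    rw [e]
    calc (ω₂ * x.1 i ^ 2) * (lam * x.1 i ^ 4) ≤ (2 * H) * (4 * H) :=
          mul_le_mul hq2 hq4 (by positivity) (by positivity)
      _ = 8 * H ^ 2 := by ring
  have hωl : 0 < ω₂ * lam := mul_pos hω hl
  rw [div_mul_eq_mul_div, le_div_iff₀ hωl]
  nlinarith

/-- On a bond `l = k + 1`: `r² ≤ 2H`, `β r⁴ ≤ 4H` and `V'(r)² ≤ (3+β)²(1+H)²` for `r = q_l − q_k`. [folklore] -/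
theorem pinnedChain_bond_bounds (hω : 0 ≤ ω₂) (hl : 0 ≤ lam) (hβ : 0 ≤ β) (γ : ℝ) (N : ℕ) (x : PhaseSpace N)
    {k l : Fin N} (hlk : l.val = k.val + 1) :
    (x.1 l - x.1 k) ^ 2 ≤ 2 * (pinnedChain ω₂ lam β γ).hamiltonian N x ∧
      β * (x.1 l - x.1 k) ^ 4 ≤ 4 * (pinnedChain ω₂ lam β γ).hamiltonian N x ∧
      (deriv (pinnedChain ω₂ lam β γ).V (x.1 l - x.1 k)) ^ 2 ≤
        (3 + β) ^ 2 * (1 + (pinnedChain ω₂ lam β γ).hamiltonian N x) ^ 2 := by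
  have hb := pinnedChain_bond_le_hamiltonian hω hl hβ γ N x hlk
  have hV := abs_deriv_V_le hβ hb
  refine ⟨by nlinarith [mul_nonneg hβ (by positivity : (0:ℝ) ≤ (x.1 l - x.1 k) ^ 4)],
    by nlinarith [sq_nonneg (x.1 l - x.1 k)], ?_⟩
  rw [pinnedChain_deriv_V, ← sq_abs, ← mul_pow]
  exact pow_le_pow_left₀ (abs_nonneg _) hV 2

/-- `r⁶ ≤ (8/β)(1+H)²` on a bond (`β > 0`). [folklore] -/
theorem pinnedChain_bond_pow_six_le (hω : 0 ≤ ω₂) (hl : 0 ≤ lam) (hβ : 0 < β) (γ : ℝ) (N : ℕ) (x : PhaseSpace N)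
    {k l : Fin N} (hlk : l.val = k.val + 1) :
    (x.1 l - x.1 k) ^ 6 ≤ 8 / β * (1 + (pinnedChain ω₂ lam β γ).hamiltonian N x) ^ 2 := by
  set H := (pinnedChain ω₂ lam β γ).hamiltonian N x
  obtain ⟨h2, h4, -⟩ := pinnedChain_bond_bounds hω hl hβ.le γ N x hlk
  have hH0 : 0 ≤ H := pinnedChain_hamiltonian_nonneg hω hl hβ.le γ N x
  have hprod : β * (x.1 l - x.1 k) ^ 6 ≤ 8 * H ^ 2 := by
    have e : β * (x.1 l - x.1 k) ^ 6 = (x.1 l - x.1 k) ^ 2 * (β * (x.1 l - x.1 k) ^ 4) := by ring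
    rw [e]
    calc (x.1 l - x.1 k) ^ 2 * (β * (x.1 l - x.1 k) ^ 4) ≤ (2 * H) * (4 * H) :=
          mul_le_mul h2 h4 (by positivity) (by positivity)
      _ = 8 * H ^ 2 := by ring
  rw [div_mul_eq_mul_div, le_div_iff₀ hβ]
  nlinarith

/-- `|∂_{q_i}H| ≤ C_N (1 + H)` with the constant of `pinnedChain_sum_abs_partialQ_le`. [folklore] -/
theorem pinnedChain_abs_partialQ_le (hω : 0 < ω₂) (hl : 0 ≤ lam) (hβ : 0 ≤ β) (γ : ℝ) (N : ℕ)
    (x : PhaseSpace N) (i : Fin N) :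
    |partialQ i ((pinnedChain ω₂ lam β γ).hamiltonian N) x| ≤
      N * (ω₂ / 2 + 3 + lam / ω₂ + N ^ 2 * (3 + β)) * (1 + (pinnedChain ω₂ lam β γ).hamiltonian N x) :=
  (Finset.single_le_sum (f := fun j => |partialQ j ((pinnedChain ω₂ lam β γ).hamiltonian N) x|)
    (fun _ _ => abs_nonneg _) (Finset.mem_univ i)).trans (pinnedChain_sum_abs_partialQ_le hω hl hβ γ N x)

/-! ### Integration by parts against `e^{-H/T}`: position virial and Gaussian momentum identities -/

/-- **Position virial identity.** For `1 ≤ n ≤ 3`: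
`∫ q_i^n ∂_{q_i}H e^{-H/T} = n T ∫ q_i^{n-1} e^{-H/T}` (integration by parts in `q_i`:
`q_i^n ∂_{q_i}H e^{-H/T} = -T q_i^n ∂_{q_i} e^{-H/T}`). [folklore] -/
theorem pinnedChain_integral_position_pow_mul_partialQ (hω : 0 < ω₂) (hl : 0 < lam) (hβ : 0 ≤ β) (γ : ℝ)
    (N : ℕ) {T : ℝ} (hT : 0 < T) (i : Fin N) {n : ℕ} (hn1 : 1 ≤ n) (hn : n ≤ 3) :
    ∫ x, x.1 i ^ n * partialQ i ((pinnedChain ω₂ lam β γ).hamiltonian N) x *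
        (pinnedChain ω₂ lam β γ).gibbsDensity N T x =
      T * n * ∫ x, x.1 i ^ (n - 1) * (pinnedChain ω₂ lam β γ).gibbsDensity N T x := by
  set P := pinnedChain ω₂ lam β γ with hP
  have hH1 : ContDiff ℝ 1 (P.hamiltonian N) := pinnedChain_contDiff_hamiltonian ω₂ lam β γ N
  have hHd : Differentiable ℝ (P.hamiltonian N) := hH1.differentiable one_ne_zero
  have hWc : Continuous (partialQ i (P.hamiltonian N)) := P.continuous_partialQ_hamiltonian hH1 i
  set CN : ℝ := N * (ω₂ / 2 + 3 + lam / ω₂ + N ^ 2 * (3 + β)) with hCN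
  have hCN0 : 0 ≤ CN := by
    have : 0 ≤ lam / ω₂ := div_nonneg hl.le hω.le
    positivity
  -- integrability of the three products
  have hpow_int : ∀ m : ℕ, m ≤ 4 → Integrable fun x => x.1 i ^ m * P.gibbsDensity N T x := by
    intro m hm
    refine pinnedChain_integrable_mul_gibbsDensity_of_le_pow hω hl.le hβ γ N hT 1 (by fun_prop)
      (C := 1 + 4 / lam) fun x => ?_
    rw [pow_one]
    exact pinnedChain_abs_position_pow_le hω.le hl hβ γ N x i hm
  have hFg' : Integrable fun x => x.1 i ^ n * (-(partialQ i (P.hamiltonian N) x / T) * P.gibbsDensity N T x) := by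
    have h := pinnedChain_integrable_mul_gibbsDensity_of_le_pow hω hl.le hβ γ N hT 2
      (g := fun x => x.1 i ^ n * partialQ i (P.hamiltonian N) x) ((by fun_prop : Continuous fun x : PhaseSpace N => x.1 i ^ n).mul hWc)
      (C := (1 + 4 / lam) * CN) fun x => ?_
    · refine (h.const_mul (-T⁻¹)).congr (Filter.Eventually.of_forall fun x => ?_)
      simp only
      ring
    · rw [abs_mul]
      have h1 := pinnedChain_abs_position_pow_le hω.le hl hβ γ N x i (show n ≤ 4 by omega)
      have h2 := pinnedChain_abs_partialQ_le hω hl.le hβ γ N x i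
      have hH0 := pinnedChain_hamiltonian_nonneg hω.le hl.le hβ γ N x
      calc |x.1 i ^ n| * |partialQ i (P.hamiltonian N) x|
          ≤ ((1 + 4 / lam) * (1 + P.hamiltonian N x)) * (CN * (1 + P.hamiltonian N x)) :=
            mul_le_mul h1 h2 (abs_nonneg _) (by positivity)
        _ = (1 + 4 / lam) * CN * (1 + P.hamiltonian N x) ^ 2 := by ring
  have e := integral_mul_eq_neg_of_hasLineDerivAt_of_integrable
    (F := fun x : PhaseSpace N => x.1 i ^ n)
    (F' := fun x : PhaseSpace N => (n : ℝ) * x.1 i ^ (n - 1))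
    (g := P.gibbsDensity N T)
    (g' := fun x => -(partialQ i (P.hamiltonian N) x / T) * P.gibbsDensity N T x)
    (v := ((Pi.single i 1, 0) : PhaseSpace N)) ?_ hFg' (hpow_int n (by omega))
    (fun x => hasLineDerivAt_position_pow n x i)
    (fun x => P.hasLineDerivAt_gibbsDensity (P.hasLineDerivAt_hamiltonian_unitQ hHd x i))
  · have lhs : ∫ x, x.1 i ^ n * (-(partialQ i (P.hamiltonian N) x / T) * P.gibbsDensity N T x) =
        -T⁻¹ * ∫ x, x.1 i ^ n * partialQ i (P.hamiltonian N) x * P.gibbsDensity N T x := by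
      rw [← integral_const_mul]
      refine integral_congr_ae (Filter.Eventually.of_forall fun x => ?_)
      ring
    have rhs : ∫ x, (n : ℝ) * x.1 i ^ (n - 1) * P.gibbsDensity N T x =
        (n : ℝ) * ∫ x, x.1 i ^ (n - 1) * P.gibbsDensity N T x := by
      rw [← integral_const_mul]
      refine integral_congr_ae (Filter.Eventually.of_forall fun x => ?_)
      ring
    rw [lhs, rhs] at e
    have hTne : T ≠ 0 := hT.ne'
    have e2 : T⁻¹ * ∫ x, x.1 i ^ n * partialQ i (P.hamiltonian N) x * P.gibbsDensity N T x =
        (n : ℝ) * ∫ x, x.1 i ^ (n - 1) * P.gibbsDensity N T x := by linarith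
    calc ∫ x, x.1 i ^ n * partialQ i (P.hamiltonian N) x * P.gibbsDensity N T x
        = T * (T⁻¹ * ∫ x, x.1 i ^ n * partialQ i (P.hamiltonian N) x * P.gibbsDensity N T x) := by
          rw [← mul_assoc, mul_inv_cancel₀ hTne, one_mul]
      _ = T * n * ∫ x, x.1 i ^ (n - 1) * P.gibbsDensity N T x := by rw [e2, mul_assoc]
  · exact ((hpow_int (n - 1) (by omega)).const_mul (n : ℝ)).congr
      (Filter.Eventually.of_forall fun x => by simp only; ring)

/-- For a continuous function `G` of the positions with `|G| ≤ C(1+H)²`: `G e^{-H/T}`, `p_k G e^{-H/T}` and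
`p_k² G e^{-H/T}` are Lebesgue integrable. [folklore] -/
theorem pinnedChain_integrable_momentum_pow_mul_posFun (hω : 0 < ω₂) (hl : 0 ≤ lam) (hβ : 0 ≤ β) (γ : ℝ)
    (N : ℕ) {T : ℝ} (hT : 0 < T) (k : Fin N) {G : (Fin N → ℝ) → ℝ} (hG : Continuous G) {C : ℝ}
    (hGle : ∀ x : PhaseSpace N, |G x.1| ≤ C * (1 + (pinnedChain ω₂ lam β γ).hamiltonian N x) ^ 2) :
    Integrable (fun x => G x.1 * (pinnedChain ω₂ lam β γ).gibbsDensity N T x) ∧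
      Integrable (fun x => x.2 k * G x.1 * (pinnedChain ω₂ lam β γ).gibbsDensity N T x) ∧
      Integrable (fun x => x.2 k ^ 2 * G x.1 * (pinnedChain ω₂ lam β γ).gibbsDensity N T x) := by
  set P := pinnedChain ω₂ lam β γ with hP
  have hGc : Continuous fun x : PhaseSpace N => G x.1 := hG.comp continuous_fst
  have hp2H : ∀ x : PhaseSpace N, x.2 k ^ 2 ≤ 2 * P.hamiltonian N x := by
    intro x
    have h := pinnedChain_harmonic_le_hamiltonian (ω₂ := ω₂) hl hβ γ N x
    have h1 : x.2 k ^ 2 / 2 ≤ ∑ j, x.2 j ^ 2 / 2 :=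
      Finset.single_le_sum (f := fun j => x.2 j ^ 2 / 2) (fun _ _ => by positivity) (Finset.mem_univ k)
    have h2 : 0 ≤ ∑ j, ω₂ * x.1 j ^ 2 / 2 := Finset.sum_nonneg fun _ _ => by positivity
    linarith
  have hp1 : ∀ x : PhaseSpace N, |x.2 k| ≤ 1 + P.hamiltonian N x := by
    intro x
    have := abs_le_half_add_sq_half (x.2 k)
    linarith [hp2H x]
  refine ⟨pinnedChain_integrable_mul_gibbsDensity_of_le_pow hω hl hβ γ N hT 2 hGc hGle, ?_, ?_⟩
  · refine pinnedChain_integrable_mul_gibbsDensity_of_le_pow hω hl hβ γ N hT 3 ((by fun_prop : Continuous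
      fun x : PhaseSpace N => x.2 k).mul hGc) (C := C) fun x => ?_
    rw [abs_mul]
    have hH0 := pinnedChain_hamiltonian_nonneg hω.le hl hβ γ N x
    have hC0 : 0 ≤ C * (1 + P.hamiltonian N x) ^ 2 := (abs_nonneg _).trans (hGle x)
    calc |x.2 k| * |G x.1| ≤ (1 + P.hamiltonian N x) * (C * (1 + P.hamiltonian N x) ^ 2) :=
          mul_le_mul (hp1 x) (hGle x) (abs_nonneg _) (by positivity)
      _ = C * (1 + P.hamiltonian N x) ^ 3 := by ring
  · refine pinnedChain_integrable_mul_gibbsDensity_of_le_pow hω hl hβ γ N hT 3 ((by fun_prop : Continuous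
      fun x : PhaseSpace N => x.2 k ^ 2).mul hGc) (C := 2 * C) fun x => ?_
    rw [abs_mul, abs_of_nonneg (sq_nonneg _)]
    have hH0 := pinnedChain_hamiltonian_nonneg hω.le hl hβ γ N x
    have hC0 : 0 ≤ C * (1 + P.hamiltonian N x) ^ 2 := (abs_nonneg _).trans (hGle x)
    have hp2 : x.2 k ^ 2 ≤ 2 * (1 + P.hamiltonian N x) := by linarith [hp2H x]
    calc x.2 k ^ 2 * |G x.1| ≤ (2 * (1 + P.hamiltonian N x)) * (C * (1 + P.hamiltonian N x) ^ 2) :=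
          mul_le_mul hp2 (hGle x) (abs_nonneg _) (by positivity)
      _ = 2 * C * (1 + P.hamiltonian N x) ^ 3 := by ring

/-- **Gaussian momentum identity with a configurational weight.** For a continuous function `G` of the positions
with `|G| ≤ C(1+H)²`: `∫ p_k² G(q) e^{-H/T} = T ∫ G(q) e^{-H/T}` (integration by parts in `p_k`; the momenta are
`N(0,T)` and independent of the positions under `e^{-H/T}`). [folklore] -/
theorem pinnedChain_integral_momentum_sq_mul_posFun (hω : 0 < ω₂) (hl : 0 ≤ lam) (hβ : 0 ≤ β) (γ : ℝ)
    (N : ℕ) {T : ℝ} (hT : 0 < T) (k : Fin N) {G : (Fin N → ℝ) → ℝ} (hG : Continuous G) {C : ℝ}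
    (hGle : ∀ x : PhaseSpace N, |G x.1| ≤ C * (1 + (pinnedChain ω₂ lam β γ).hamiltonian N x) ^ 2) :
    ∫ x, x.2 k ^ 2 * G x.1 * (pinnedChain ω₂ lam β γ).gibbsDensity N T x =
      T * ∫ x, G x.1 * (pinnedChain ω₂ lam β γ).gibbsDensity N T x := by
  set P := pinnedChain ω₂ lam β γ with hP
  obtain ⟨hF'g, hFg, h2⟩ := pinnedChain_integrable_momentum_pow_mul_posFun hω hl hβ γ N hT k hG hGle
  have hFg' : Integrable fun x => x.2 k * G x.1 * (-(x.2 k / T) * P.gibbsDensity N T x) := by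
    refine (h2.const_mul (-T⁻¹)).congr (Filter.Eventually.of_forall fun x => ?_)
    simp only
    ring
  have e := integral_mul_eq_neg_of_hasLineDerivAt_of_integrable
    (F := fun x : PhaseSpace N => x.2 k * G x.1) (F' := fun x : PhaseSpace N => G x.1)
    (g := P.gibbsDensity N T) (g' := fun x => -(x.2 k / T) * P.gibbsDensity N T x)
    (v := ((0, Pi.single k 1) : PhaseSpace N)) hF'g hFg' hFg
    (fun x => hasLineDerivAt_momentum_mul_posFun G x k)
    (fun x => P.hasLineDerivAt_gibbsDensity (P.hasLineDerivAt_hamiltonian_unitP N x k))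
  have lhs : ∫ x, x.2 k * G x.1 * (-(x.2 k / T) * P.gibbsDensity N T x) =
      -T⁻¹ * ∫ x, x.2 k ^ 2 * G x.1 * P.gibbsDensity N T x := by
    rw [← integral_const_mul]
    refine integral_congr_ae (Filter.Eventually.of_forall fun x => ?_)
    ring
  rw [lhs] at e
  have hTne : T ≠ 0 := hT.ne'
  have e2 : T⁻¹ * ∫ x, x.2 k ^ 2 * G x.1 * P.gibbsDensity N T x = ∫ x, G x.1 * P.gibbsDensity N T x := by
    linarith
  calc ∫ x, x.2 k ^ 2 * G x.1 * P.gibbsDensity N T x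
      = T * (T⁻¹ * ∫ x, x.2 k ^ 2 * G x.1 * P.gibbsDensity N T x) := by
        rw [← mul_assoc, mul_inv_cancel₀ hTne, one_mul]
    _ = T * ∫ x, G x.1 * P.gibbsDensity N T x := by rw [e2]

end Pinned

end Summit.AtomisticToContinuum.FouriersLaw.Theorems.LightConeBondHeat

end
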